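import Mathlib
import HarnessLib

/-!
# R90-TF · S10 — GERM REGROUPING of an absolutely convergent class sum: `Σ'_c w(c)·h(t(c)) = Σ'_t (Σ'_{t(c) = t} w(c))·h(t)`
# (the book-keeping behind Props. 13.6.1 ∕ 13.6.2 «each term in each sum above defines an e.v.p. on G̃ … regroup», the (D2) blocks of S10 FILE D)

Cell `hodgecm-mathlib`, crux H413 (`stmt-HodgeConjecture-24833`, lane `--supports … --as helper`), route of record `HCCMUnconditional`; programme R90-TF
(brief `director/R90-BRIEF.v2.md` 1f40d54518340a35); typed by R90-C138-typ2 (g2) for S10 FILE D ED. 2 (`Lines/R90_S10_TFDecompositionD.lean` 806e42d45b021177,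
blocks `DiscreteGermExpansionHyp` ∕ `HGermExpansionHyp`: «`Σ_π m(π) Tr π(φ ⊗ (frozen) ⊗ f^S) = Σ'_t cD_t(φ) · (f^S)^∧(t)`, regroup the absolutely convergent
discrete sum by the e.v.p. `ψ_G(t(π))`»).  PURE MATHLIB, generic in the class type `C`, the germ type `Γ`, the weight `w : C → ℂ` (intended `w(c) = m(c) ·
Tr c_S(f_S)`, Flath) and the germ functional `h : Γ → ℂ` (intended `h(t) = (f^S)^∧(t)`).
WHAT IT SAYS.  If `Σ_c w(c) · h(evp c)` is summable (in `ℂ`: absolutely), then with the GERM COEFFICIENT `coeff(t) := Σ'_{c : evp c = t} w(c)` the regrouped series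
`Σ_t coeff(t) · h(t)` is summable with the same sum.  (No hypothesis on the fibres: in `ℂ` every subfamily of a summable family is summable, and `tsum_mul_right`
is unconditional, so a fibre on which `w` alone is not summable has `h(t) = 0` or contributes its honest value.)
PROOF: transport along `Equiv.sigmaFiberEquiv evp : (Σ t, {c // evp c = t}) ≃ C`, then `Summable.sigma` ∕ `Summable.tsum_sigma` (complete space `ℂ`) and
`tsum_mul_right` on each fibre — the same transport as ★ `R90.S10.exists_countableExpansion_of_finite_fibres` (p861916), WITHOUT finiteness of fibres.
THEOREMS ONLY (one public theorem; no `def`, no instance, no notation, no `sorry`).  HONEST LABEL: HC_CM is proved only modulo the 7 printed citations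
(2 remaining named inputs: hLiu418 = stmt-HodgeConjecture-24832, h413 = stmt-HodgeConjecture-24833) until rung 0 closes; this file is summation book-keeping
and proves no printed statement by itself.

## References
* [Rogawski1990] J. D. Rogawski, *Automorphic Representations of Unitary Groups in Three Variables*, Ann. of Math. Stud. 123 (1990), §13.6 Props. 13.6.1,
  13.6.2 pp. 209–210 («SΘ_G(f) is equal to the sum of the following terms»; e.v.p.'s p. 209), §13.7 pp. 210–211 (separating by Hecke eigenvalues).
* [FlathCorvallis1979] D. Flath, *Decomposition of representations into tensor products*, Corvallis (1979), Thm. 3 (`Tr π(f_S ⊗ f^S) = Tr π_S(f_S) · (f^S)^∧(t(π))`).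
-/

set_option autoImplicit false
-- the mandated namespace repeats the single-problem summit's segment (`HodgeConjecture.HodgeConjecture`)
set_option linter.dupNamespace false

noncomputable section

namespace Summit.HodgeConjecture.HodgeConjecture.R90.S10

/-- **Germ regrouping.**  Let `evp : C → Γ`, `w : C → ℂ`, `h : Γ → ℂ` with `Σ_c w(c) · h(evp c)` summable.  Then, with the germ coefficient
`coeff(t) = Σ'_{c : evp c = t} w(c)`, the series `Σ_t coeff(t) · h(t)` is summable and `Σ'_t coeff(t) · h(t) = Σ'_c w(c) · h(evp c)`.  At S10 FILE D's (D2)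
blocks (`C :=` discrete classes of `U(Φ₃)`, `w(c) := m(c) · Tr c_S(φ ⊗ frozen_S)`, `evp := ψ_G ∘ t`, `h := (f^S)^∧`) this is «regroup (13.6.1) by e.v.p.»
[Rogawski1990 Props. 13.6.1∕13.6.2 pp. 209–210]. [cite: Rogawski1990, §13.6 pp. 209–210; §13.7 pp. 210–211] [cite: FlathCorvallis1979, Thm. 3] -/
theorem germRegroup_summable_and_tsum_eq {C Γ : Type*} (evp : C → Γ) (w : C → ℂ) (h : Γ → ℂ)
    (hs : Summable fun c => w c * h (evp c)) :
    Summable (fun t : Γ => (∑' q : {c : C // evp c = t}, w q.1) * h t) ∧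
      ∑' t : Γ, (∑' q : {c : C // evp c = t}, w q.1) * h t = ∑' c, w c * h (evp c) := by
  -- the summand transported to the fibre decomposition `Σ t, {c // evp c = t} ≃ C`
  have hpt : ∀ p : (Σ t : Γ, {c : C // evp c = t}),
      w (Equiv.sigmaFiberEquiv evp p) * h (evp (Equiv.sigmaFiberEquiv evp p)) = w p.2.1 * h p.1 := by
    rintro ⟨t, c, hc⟩
    simp only [Equiv.sigmaFiberEquiv_apply, hc]
  have hF : Summable (fun p : (Σ t : Γ, {c : C // evp c = t}) => w p.2.1 * h p.1) :=
    (((Equiv.sigmaFiberEquiv evp).summable_iff.2 hs).congr hpt)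
  -- each fibre sum factors: `Σ'_{q} w q · h t = (Σ'_{q} w q) · h t` (unconditionally)
  have hfibre : ∀ t : Γ, ∑' q : {c : C // evp c = t}, w q.1 * h t = (∑' q : {c : C // evp c = t}, w q.1) * h t :=
    fun t => tsum_mul_right
  refine ⟨hF.sigma.congr hfibre, ?_⟩
  calc ∑' t : Γ, (∑' q : {c : C // evp c = t}, w q.1) * h t
      = ∑' t : Γ, ∑' q : {c : C // evp c = t}, w q.1 * h t := tsum_congr fun t => (hfibre t).symm
    _ = ∑' p : (Σ t : Γ, {c : C // evp c = t}), w p.2.1 * h p.1 := hF.tsum_sigma.symm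
    _ = ∑' p : (Σ t : Γ, {c : C // evp c = t}), w (Equiv.sigmaFiberEquiv evp p) * h (evp (Equiv.sigmaFiberEquiv evp p)) := tsum_congr fun p => (hpt p).symm
    _ = ∑' c, w c * h (evp c) := (Equiv.sigmaFiberEquiv evp).tsum_eq (fun c => w c * h (evp c))

end Summit.HodgeConjecture.HodgeConjecture.R90.S10

end
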